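import Summits.AtomisticToContinuum.FouriersLaw.Theorems.ContactStieltjesMeasureStieltjesRepresentationPencilCrossCutoff

/-!
# Stub `stub_pencilOfGreenKubo` of line `cayley-pencil` (crux `ContactStieltjesMeasure.StieltjesRepresentation`,
# stmt-AtomisticToContinuum-15248), part 4b: the cross-friction pairing identity of two Poisson solutions

Helper file (`--supports stmt-AtomisticToContinuum-15248`), sequel of part 4a (`cross_cutoff_identity`). Pinned anharmonic
chain `P_γ = pinnedChain ω₂ lam β γ` (`ω₂ > 0`, `lam, β ≥ 0`), `N ≥ 2`, both baths at `T > 0`, Gibbs weight `ρ = e^{-H/T}`,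
generators `L_γ, L_{γ₁}` at two frictions, `L_γ† k = (L_γ(k∘Θ))∘Θ`.

* `cross_pairing` — letting `R → ∞` in the cutoff identity (dominated convergence for the `χ_R`-terms; the `∂χ_R`, `χ'`,
  `χ''` terms are `O(1/R)`): **`∫ w v' ρ = ∫ v w' ρ + (γ - γ₁) T Σ_{b∈{0,N-1}} ∫ ∂_{p_b} w' ∂_{p_b} w ρ`** for smooth
  `w, w'`, continuous `v, v'`, all `O(e^{H/(8T)})`, with `L_{γ₁} w = -v`, `L_γ† w' = -v'` and
  `(∂_{p_b}w)²ρ, (∂_{p_b}w')²ρ ∈ L¹`. At `γ = γ₁` this is `⟨w, L_γ† w'⟩ = ⟨L_γ w, w'⟩` for Poisson-class functions;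
  across frictions it is the weak form of the pencil resolvent identity `R_γ - R_{γ₁} = (γ₁ - γ) R_γ S R_{γ₁}`.
No definitions.
-/

noncomputable section

open MeasureTheory Filter Topology Set Function
open scoped ContDiff
open Literature.MathematicalPhysics.KineticTheory.HeatConduction

namespace Summit.AtomisticToContinuum.FouriersLaw.Theorems.ContactStieltjesMeasure.CayleyPencil

namespace Pencil

open Summit.AtomisticToContinuum.FouriersLaw.Theorems.OddSectorIrreversibility
  (contDiff_energyCutoff tendsto_energyCutoff_atTop)
open Summit.AtomisticToContinuum.FouriersLaw.Theorems.HonestZwanzig.OrthogonalOhmLine.DirichletBound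
  (abs_partialP_energyCutoff_le abs_cross_le_amgm integrable_weights)
open Summit.AtomisticToContinuum.FouriersLaw.Theorems.SubdiffusiveBondHeat
  (exists_bound_deriv_smoothCutoff exists_bound_deriv_deriv_smoothCutoff)

variable {N : ℕ}

section Pinned

variable {ω₂ lam β : ℝ} (hω : 0 < ω₂) (hl : 0 ≤ lam) (hβ : 0 ≤ β) (hN : 2 ≤ N) {T : ℝ} (hT : 0 < T)
include hω hl hβ hN hT

/-! ### The limit `R → ∞` -/

/-- **The cross-friction pairing identity.** For `γ ≥ 0`, `γ₁ ∈ ℝ`, smooth `w, w'` and continuous `v, v'`, all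
`O(e^{H/(8T)})`, with `L_{γ₁} w = -v`, `L_γ† w' = -v'` pointwise and `(∂_{p_b}w)²ρ, (∂_{p_b}w')²ρ ∈ L¹` at both bath
sites: **`∫ w v' ρ = ∫ v w' ρ + (γ - γ₁)T(∫ ∂_{p_0}w' ∂_{p_0}w ρ + ∫ ∂_{p_{N-1}}w' ∂_{p_{N-1}}w ρ)`** (the cutoff identity
as `R → ∞`: dominated convergence for the `χ_R`-terms, the `∂χ_R`, `χ'`, `χ''` terms are `O(1/R)`). [folklore] -/
theorem cross_pairing {γ : ℝ} (hγ : 0 ≤ γ) (γ₁ : ℝ) {w v w' v' : PhaseSpace N → ℝ} (hw : ContDiff ℝ ∞ w)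
    (hw' : ContDiff ℝ ∞ w') (hvc : Continuous v) (hv'c : Continuous v')
    (hLw : ∀ x, (pinnedChain ω₂ lam β γ₁).generator N T T w x = -v x)
    (hLw' : ∀ x, (pinnedChain ω₂ lam β γ).generator N T T (fun y : PhaseSpace N => w' (y.1, -y.2)) (x.1, -x.2) =
      -v' x)
    {Cw Cv Cw' Cv' : ℝ}
    (hwb : ∀ z, |w z| ≤ Cw * Real.exp ((pinnedChain ω₂ lam β γ).hamiltonian N z / (8 * T)))
    (hvb : ∀ z, |v z| ≤ Cv * Real.exp ((pinnedChain ω₂ lam β γ).hamiltonian N z / (8 * T)))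
    (hw'b : ∀ z, |w' z| ≤ Cw' * Real.exp ((pinnedChain ω₂ lam β γ).hamiltonian N z / (8 * T)))
    (hv'b : ∀ z, |v' z| ≤ Cv' * Real.exp ((pinnedChain ω₂ lam β γ).hamiltonian N z / (8 * T)))
    (hD₀ : Integrable fun x => (partialP ⟨0, by omega⟩ w x) ^ 2 * (pinnedChain ω₂ lam β γ).gibbsDensity N T x)
    (hD₁ : Integrable fun x => (partialP ⟨N - 1, by omega⟩ w x) ^ 2 * (pinnedChain ω₂ lam β γ).gibbsDensity N T x)
    (hD'₀ : Integrable fun x => (partialP ⟨0, by omega⟩ w' x) ^ 2 * (pinnedChain ω₂ lam β γ).gibbsDensity N T x)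
    (hD'₁ : Integrable fun x => (partialP ⟨N - 1, by omega⟩ w' x) ^ 2 * (pinnedChain ω₂ lam β γ).gibbsDensity N T x) :
    ∫ x, w x * v' x * (pinnedChain ω₂ lam β γ).gibbsDensity N T x =
      (∫ x, v x * w' x * (pinnedChain ω₂ lam β γ).gibbsDensity N T x) +
      (γ - γ₁) * T *
        ((∫ x, partialP ⟨0, by omega⟩ w' x * partialP ⟨0, by omega⟩ w x *
            (pinnedChain ω₂ lam β γ).gibbsDensity N T x) +
          ∫ x, partialP ⟨N - 1, by omega⟩ w' x * partialP ⟨N - 1, by omega⟩ w x *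
            (pinnedChain ω₂ lam β γ).gibbsDensity N T x) := by
  set P := pinnedChain ω₂ lam β γ with hP
  set ρ := P.gibbsDensity N T with hρ
  set H := P.hamiltonian N with hH
  set b₀ : Fin N := ⟨0, by omega⟩ with hb₀
  set b₁ : Fin N := ⟨N - 1, by omega⟩ with hb₁
  obtain ⟨M, hM0, hM⟩ := exists_bound_deriv_smoothCutoff
  obtain ⟨M₂, hM₂0, hM₂⟩ := exists_bound_deriv_deriv_smoothCutoff
  set χ : ℝ → PhaseSpace N → ℝ := fun R x => smoothCutoff (H x / R) with hχ
  have hρc : Continuous ρ := pinnedChain_continuous_gibbsDensity ω₂ lam β γ N T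
  have hρ0 : ∀ x, 0 ≤ ρ x := fun x => (P.gibbsDensity_pos N T x).le
  have hHc : Continuous H := pinnedChain_continuous_hamiltonian ω₂ lam β γ N
  have hχs : ∀ R, ContDiff ℝ ∞ (χ R) := fun R => contDiff_energyCutoff (ω₂ := ω₂) (lam := lam) (β := β) γ N R
  have hχcont : ∀ R, Continuous (χ R) := fun R => (hχs R).continuous
  have hχ0 : ∀ R x, 0 ≤ χ R x := fun R x => smoothCutoff_nonneg _
  have hχ1 : ∀ R x, χ R x ≤ 1 := fun R x => smoothCutoff_le_one _
  have hlimχ : ∀ x, Tendsto (fun R => χ R x) atTop (𝓝 1) := fun x => tendsto_energyCutoff_atTop P N x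
  have hPwc : ∀ i, Continuous (partialP i w) := fun i => continuous_partialP hw (by simp) i
  have hPw'c : ∀ i, Continuous (partialP i w') := fun i => continuous_partialP hw' (by simp) i
  have hPχc : ∀ R i, Continuous (partialP i (χ R)) := fun R i => continuous_partialP (hχs R) (by simp) i
  have hpc : ∀ i : Fin N, Continuous fun x : PhaseSpace N => x.2 i := fun i =>
    (continuous_apply i).comp continuous_snd
  have hdχc : ∀ R, Continuous fun x => deriv smoothCutoff (H x / R) := fun R =>
    ((contDiff_smoothCutoff (n := 1)).continuous_deriv le_rfl).comp (hHc.div_const R)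
  have hddχc : ∀ R, Continuous fun x => deriv (deriv smoothCutoff) (H x / R) := fun R =>
    (((contDiff_smoothCutoff (n := 2)).deriv').continuous_deriv le_rfl).comp (hHc.div_const R)
  -- static integrability (`integrable_weights`)
  obtain ⟨hwv', hpw⟩ := integrable_weights (N := N) (γ := γ) (w := w) (g := v') hω hl hβ hT hw.continuous hv'c hwb hv'b
  obtain ⟨hvw', hpw'⟩ := integrable_weights (N := N) (γ := γ) (w := w') (g := v) hω hl hβ hT hw'.continuous hvc hw'b hvb
  obtain ⟨hww', -⟩ := integrable_weights (N := N) (γ := γ) (w := w') (g := w) hω hl hβ hT hw'.continuous hw.continuous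
    hw'b hwb
  obtain ⟨hww, -⟩ := integrable_weights (N := N) (γ := γ) (w := w) (g := w) hω hl hβ hT hw.continuous hw.continuous
    hwb hwb
  obtain ⟨hw'w', -⟩ := integrable_weights (N := N) (γ := γ) (w := w') (g := w') hω hl hβ hT hw'.continuous
    hw'.continuous hw'b hw'b
  have hD : ∀ b, b = b₀ ∨ b = b₁ → Integrable fun x => (partialP b w x) ^ 2 * ρ x := by
    rintro b (rfl | rfl); exacts [hD₀, hD₁]
  have hD' : ∀ b, b = b₀ ∨ b = b₁ → Integrable fun x => (partialP b w' x) ^ 2 * ρ x := by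
    rintro b (rfl | rfl); exacts [hD'₀, hD'₁]
  -- (L1), (L2): the `χ_R`-weighted pairings converge (dominated convergence)
  have hL : ∀ {a c : PhaseSpace N → ℝ}, Continuous a → Continuous c →
      Integrable (fun x => a x * c x * ρ x) →
      Tendsto (fun R => ∫ x, χ R x * a x * c x * ρ x) atTop (𝓝 (∫ x, a x * c x * ρ x)) := by
    intro a c ha hc hi
    refine tendsto_integral_filter_of_dominated_convergence (fun x => ‖a x * c x * ρ x‖) ?_ ?_ hi.norm ?_
    · exact Eventually.of_forall fun R => ((((hχcont R).mul ha).mul hc).mul hρc).aestronglyMeasurable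
    · refine Eventually.of_forall fun R => Eventually.of_forall fun x => ?_
      rw [Real.norm_eq_abs, Real.norm_eq_abs, show χ R x * a x * c x * ρ x = χ R x * (a x * c x * ρ x) by ring,
        abs_mul, abs_of_nonneg (hχ0 R x)]
      calc χ R x * |a x * c x * ρ x| ≤ 1 * |a x * c x * ρ x| :=
          mul_le_mul_of_nonneg_right (hχ1 R x) (abs_nonneg _)
        _ = |a x * c x * ρ x| := one_mul _
    · exact Eventually.of_forall fun x => by
        have e : (fun n => χ n x * a x * c x * ρ x) = fun n => χ n x * (a x * c x * ρ x) := by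
          funext n; ring
        rw [e]
        simpa using ((hlimχ x).mul_const (a x * c x * ρ x))
  have hwv'' : Integrable fun x => w x * v' x * ρ x :=
    hwv'.congr (Eventually.of_forall fun x => by show v' x * w x * ρ x = w x * v' x * ρ x; ring)
  have hL1 := hL hw.continuous hv'c hwv''
  have hL2 := hL hvc hw'.continuous hvw'
  -- (L3): the cut-off cross Dirichlet forms converge (dominated convergence)
  have hL3 : ∀ b, b = b₀ ∨ b = b₁ →
      Tendsto (fun R => ∫ x, χ R x * partialP b w' x * partialP b w x * ρ x) atTop
        (𝓝 (∫ x, partialP b w' x * partialP b w x * ρ x)) := by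
    intro b hb
    have hi : Integrable fun x => partialP b w' x * partialP b w x * ρ x := by
      refine Integrable.mono' (((hD' b hb).add (hD b hb)).div_const 2)
        (((hPw'c b).mul (hPwc b)).mul hρc).aestronglyMeasurable (Eventually.of_forall fun x => ?_)
      rw [Real.norm_eq_abs, abs_mul, abs_of_nonneg (hρ0 x)]
      have : |partialP b w' x * partialP b w x| ≤ ((partialP b w' x) ^ 2 + (partialP b w x) ^ 2) / 2 := by
        rw [abs_le]; constructor <;>
          nlinarith [sq_nonneg (partialP b w' x - partialP b w x), sq_nonneg (partialP b w' x + partialP b w x)]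
      calc |partialP b w' x * partialP b w x| * ρ x ≤ ((partialP b w' x) ^ 2 + (partialP b w x) ^ 2) / 2 * ρ x :=
          mul_le_mul_of_nonneg_right this (hρ0 x)
        _ = ((partialP b w' x) ^ 2 * ρ x + (partialP b w x) ^ 2 * ρ x) / 2 := by ring
    exact hL (hPw'c b) (hPwc b) hi
  -- (L4) = (L6): the `∂χ_R` cross terms are `O(1/R)`
  have hL4 : ∀ b, b = b₀ ∨ b = b₁ →
      Tendsto (fun R => ∫ x, w' x * partialP b (χ R) x * partialP b w x * ρ x) atTop (𝓝 0) := by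
    intro b hb
    set K : ℝ := ((∫ x, x.2 b ^ 2 * w' x ^ 2 * ρ x) + ∫ x, (partialP b w x) ^ 2 * ρ x) / 2 with hK
    have hbound : ∀ R, 0 < R → |∫ x, w' x * partialP b (χ R) x * partialP b w x * ρ x| ≤ M / R * K := by
      intro R hR
      have hpt : ∀ x, |w' x * partialP b (χ R) x * partialP b w x * ρ x| ≤
          M / R * ((x.2 b ^ 2 * w' x ^ 2 * ρ x + (partialP b w x) ^ 2 * ρ x) / 2) := by
        intro x
        have hd : |partialP b (χ R) x| ≤ M / R * |x.2 b| := abs_partialP_energyCutoff_le P N hR hM b x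
        have h1 : |(1 : ℝ)| ≤ 1 := by rw [abs_one]
        have hy := abs_cross_le_amgm (w := w' x) (χ := (1 : ℝ)) (dw := partialP b w x) (div_nonneg hM0 hR.le) h1 hd
        rw [mul_one] at hy
        rw [abs_mul, abs_of_nonneg (hρ0 x)]
        have h2 := mul_le_mul_of_nonneg_right hy (hρ0 x)
        have e : M / R * (((x.2 b * w' x) ^ 2 + partialP b w x ^ 2) / 2) * ρ x =
            M / R * ((x.2 b ^ 2 * w' x ^ 2 * ρ x + (partialP b w x) ^ 2 * ρ x) / 2) := by ring
        rw [e] at h2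
        exact h2
      have iI : Integrable fun x => (x.2 b ^ 2 * w' x ^ 2 * ρ x + (partialP b w x) ^ 2 * ρ x) / 2 :=
        ((hpw' b).add (hD b hb)).div_const 2
      calc |∫ x, w' x * partialP b (χ R) x * partialP b w x * ρ x|
          ≤ ∫ x, |w' x * partialP b (χ R) x * partialP b w x * ρ x| := abs_integral_le_integral_abs
        _ ≤ ∫ x, M / R * ((x.2 b ^ 2 * w' x ^ 2 * ρ x + (partialP b w x) ^ 2 * ρ x) / 2) :=
            integral_mono_of_nonneg (Eventually.of_forall fun x => abs_nonneg _) (iI.const_mul _)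
              (Eventually.of_forall hpt)
        _ = M / R * K := by rw [integral_const_mul, hK, integral_div, integral_add (hpw' b) (hD b hb)]
    have hlim : Tendsto (fun R : ℝ => M / R * K) atTop (𝓝 0) := by
      have h : Tendsto (fun R : ℝ => M * K / R) atTop (𝓝 0) := tendsto_const_nhds.div_atTop tendsto_id
      exact h.congr fun R => by ring
    refine squeeze_zero_norm' ?_ hlim
    filter_upwards [eventually_gt_atTop 0] with R hR
    rw [Real.norm_eq_abs]
    exact hbound R hR
  have hL6 : ∀ b, b = b₀ ∨ b = b₁ →
      Tendsto (fun R => ∫ x, partialP b (χ R) x * partialP b w x * w' x * ρ x) atTop (𝓝 0) := by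
    intro b hb
    refine (hL4 b hb).congr fun R => ?_
    exact integral_congr_ae (Eventually.of_forall fun x => by ring)
  -- (L5): the multiplier term is `O(1/R)`
  set G : PhaseSpace N → ℝ := fun x =>
    (w x ^ 2 + w' x ^ 2) / 2 * (γ * (M * (T + T))) * ρ x +
      (x.2 b₀ ^ 2 * w x ^ 2 * ρ x + x.2 b₀ ^ 2 * w' x ^ 2 * ρ x + x.2 b₁ ^ 2 * w x ^ 2 * ρ x +
        x.2 b₁ ^ 2 * w' x ^ 2 * ρ x) / 2 * (γ * (M + M₂ * T)) with hG
  have iG : Integrable G := by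
    have i1 : Integrable fun x => (w x ^ 2 + w' x ^ 2) / 2 * (γ * (M * (T + T))) * ρ x := by
      have := ((hww.add hw'w').div_const 2).mul_const (γ * (M * (T + T)))
      exact this.congr (Eventually.of_forall fun x => by simp only [Pi.add_apply]; ring)
    have i2 : Integrable fun x => (x.2 b₀ ^ 2 * w x ^ 2 * ρ x + x.2 b₀ ^ 2 * w' x ^ 2 * ρ x +
        x.2 b₁ ^ 2 * w x ^ 2 * ρ x + x.2 b₁ ^ 2 * w' x ^ 2 * ρ x) / 2 * (γ * (M + M₂ * T)) := by
      have := (((((hpw b₀).add (hpw' b₀)).add (hpw b₁)).add (hpw' b₁)).div_const 2).mul_const (γ * (M + M₂ * T))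
      exact this.congr (Eventually.of_forall fun x => by simp only [Pi.add_apply]; rfl)
    exact i1.add i2
  have hL5 : Tendsto (fun R => ∫ x, w x * (γ * (deriv smoothCutoff (H x / R) / R *
      (T + T - x.2 b₀ ^ 2 - x.2 b₁ ^ 2) + deriv (deriv smoothCutoff) (H x / R) / R ^ 2 *
      (T * x.2 b₀ ^ 2 + T * x.2 b₁ ^ 2))) * w' x * ρ x) atTop (𝓝 0) := by
    have hbound : ∀ R, 1 ≤ R → |∫ x, w x * (γ * (deriv smoothCutoff (H x / R) / R *
        (T + T - x.2 b₀ ^ 2 - x.2 b₁ ^ 2) + deriv (deriv smoothCutoff) (H x / R) / R ^ 2 *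
        (T * x.2 b₀ ^ 2 + T * x.2 b₁ ^ 2))) * w' x * ρ x| ≤ 1 / R * ∫ x, G x := by
      intro R hR1
      have hR : 0 < R := lt_of_lt_of_le one_pos hR1
      have hRR : 1 / R ^ 2 ≤ 1 / R := one_div_le_one_div_of_le hR (by nlinarith)
      have hpt : ∀ x, |w x * (γ * (deriv smoothCutoff (H x / R) / R *
          (T + T - x.2 b₀ ^ 2 - x.2 b₁ ^ 2) + deriv (deriv smoothCutoff) (H x / R) / R ^ 2 *
          (T * x.2 b₀ ^ 2 + T * x.2 b₁ ^ 2))) * w' x * ρ x| ≤ 1 / R * G x := by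
        intro x
        have hm1 := hM (H x / R)
        have hm2 := hM₂ (H x / R)
        have hp0 := sq_nonneg (x.2 b₀)
        have hp1 := sq_nonneg (x.2 b₁)
        -- the multiplier is bounded by `(1/R)·γ·(M(2T + p₀² + p₁²) + M₂T(p₀² + p₁²))`
        have hmul : |γ * (deriv smoothCutoff (H x / R) / R * (T + T - x.2 b₀ ^ 2 - x.2 b₁ ^ 2) +
            deriv (deriv smoothCutoff) (H x / R) / R ^ 2 * (T * x.2 b₀ ^ 2 + T * x.2 b₁ ^ 2))| ≤
            1 / R * (γ * (M * (T + T) + (M + M₂ * T) * (x.2 b₀ ^ 2 + x.2 b₁ ^ 2))) := by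
          rw [abs_mul, abs_of_nonneg hγ]
          have e1 : |deriv smoothCutoff (H x / R) / R * (T + T - x.2 b₀ ^ 2 - x.2 b₁ ^ 2)| ≤
              M / R * (T + T + x.2 b₀ ^ 2 + x.2 b₁ ^ 2) := by
            rw [abs_mul, abs_div, abs_of_pos hR]
            refine mul_le_mul (div_le_div_of_nonneg_right hm1 hR.le) ?_ (abs_nonneg _) (by positivity)
            rw [abs_le]; constructor <;> nlinarith [hT.le]
          have e2 : |deriv (deriv smoothCutoff) (H x / R) / R ^ 2 * (T * x.2 b₀ ^ 2 + T * x.2 b₁ ^ 2)| ≤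
              M₂ / R * (T * x.2 b₀ ^ 2 + T * x.2 b₁ ^ 2) := by
            rw [abs_mul, abs_div, abs_of_pos (by positivity : (0:ℝ) < R ^ 2),
              abs_of_nonneg (by positivity : (0:ℝ) ≤ T * x.2 b₀ ^ 2 + T * x.2 b₁ ^ 2)]
            refine mul_le_mul_of_nonneg_right ?_ (by positivity)
            calc |deriv (deriv smoothCutoff) (H x / R)| / R ^ 2 ≤ M₂ / R ^ 2 :=
                div_le_div_of_nonneg_right hm2 (by positivity)
              _ = M₂ * (1 / R ^ 2) := by ring
              _ ≤ M₂ * (1 / R) := mul_le_mul_of_nonneg_left hRR hM₂0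
              _ = M₂ / R := by ring
          have e3 := (abs_add_le _ _).trans (add_le_add e1 e2)
          calc γ * |deriv smoothCutoff (H x / R) / R * (T + T - x.2 b₀ ^ 2 - x.2 b₁ ^ 2) +
                deriv (deriv smoothCutoff) (H x / R) / R ^ 2 * (T * x.2 b₀ ^ 2 + T * x.2 b₁ ^ 2)|
              ≤ γ * (M / R * (T + T + x.2 b₀ ^ 2 + x.2 b₁ ^ 2) + M₂ / R * (T * x.2 b₀ ^ 2 + T * x.2 b₁ ^ 2)) :=
                mul_le_mul_of_nonneg_left e3 hγ
            _ = 1 / R * (γ * (M * (T + T) + (M + M₂ * T) * (x.2 b₀ ^ 2 + x.2 b₁ ^ 2))) := by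
                field_simp; ring
        have hww'x : |w x * w' x| ≤ (w x ^ 2 + w' x ^ 2) / 2 := by
          rw [abs_le]; constructor <;> nlinarith [sq_nonneg (w x - w' x), sq_nonneg (w x + w' x)]
        rw [show w x * (γ * (deriv smoothCutoff (H x / R) / R * (T + T - x.2 b₀ ^ 2 - x.2 b₁ ^ 2) +
            deriv (deriv smoothCutoff) (H x / R) / R ^ 2 * (T * x.2 b₀ ^ 2 + T * x.2 b₁ ^ 2))) * w' x * ρ x =
            (w x * w' x) * (γ * (deriv smoothCutoff (H x / R) / R * (T + T - x.2 b₀ ^ 2 - x.2 b₁ ^ 2) +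
            deriv (deriv smoothCutoff) (H x / R) / R ^ 2 * (T * x.2 b₀ ^ 2 + T * x.2 b₁ ^ 2))) * ρ x by ring,
          abs_mul, abs_mul, abs_of_nonneg (hρ0 x)]
        have h3 := mul_le_mul hww'x hmul (abs_nonneg _) (by positivity)
        have h4 := mul_le_mul_of_nonneg_right h3 (hρ0 x)
        refine h4.trans (le_of_eq ?_)
        simp only [hG]
        field_simp
        ring
      have hint : Integrable fun x => 1 / R * G x := iG.const_mul _
      calc |∫ x, w x * (γ * (deriv smoothCutoff (H x / R) / R *
            (T + T - x.2 b₀ ^ 2 - x.2 b₁ ^ 2) + deriv (deriv smoothCutoff) (H x / R) / R ^ 2 *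
            (T * x.2 b₀ ^ 2 + T * x.2 b₁ ^ 2))) * w' x * ρ x|
          ≤ ∫ x, |w x * (γ * (deriv smoothCutoff (H x / R) / R *
            (T + T - x.2 b₀ ^ 2 - x.2 b₁ ^ 2) + deriv (deriv smoothCutoff) (H x / R) / R ^ 2 *
            (T * x.2 b₀ ^ 2 + T * x.2 b₁ ^ 2))) * w' x * ρ x| := abs_integral_le_integral_abs
        _ ≤ ∫ x, 1 / R * G x :=
            integral_mono_of_nonneg (Eventually.of_forall fun x => abs_nonneg _) hint (Eventually.of_forall hpt)
        _ = 1 / R * ∫ x, G x := integral_const_mul _ _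
    have hlim : Tendsto (fun R : ℝ => 1 / R * ∫ x, G x) atTop (𝓝 0) := by
      have h : Tendsto (fun R : ℝ => (∫ x, G x) / R) atTop (𝓝 0) := tendsto_const_nhds.div_atTop tendsto_id
      exact h.congr fun R => by ring
    refine squeeze_zero_norm' ?_ hlim
    filter_upwards [eventually_ge_atTop 1] with R hR
    rw [Real.norm_eq_abs]
    exact hbound R hR
  -- pass to the limit in the cutoff identity
  have hRHS : Tendsto (fun R => ∫ x, χ R x * w x * v' x * ρ x) atTop
      (𝓝 ((∫ x, v x * w' x * ρ x) +
        (γ - γ₁) * T * (((∫ x, partialP b₀ w' x * partialP b₀ w x * ρ x) + 0) +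
          ((∫ x, partialP b₁ w' x * partialP b₁ w x * ρ x) + 0)) - 0 - 2 * γ * T * (0 + 0))) := by
    have h := (((hL2.add ((((hL3 b₀ (Or.inl rfl)).add (hL4 b₀ (Or.inl rfl))).add
      ((hL3 b₁ (Or.inr rfl)).add (hL4 b₁ (Or.inr rfl)))).const_mul ((γ - γ₁) * T))).sub hL5).sub
      (((hL6 b₀ (Or.inl rfl)).add (hL6 b₁ (Or.inr rfl))).const_mul (2 * γ * T)))
    refine h.congr' ?_
    filter_upwards [eventually_gt_atTop 0] with R hR
    exact (cross_cutoff_identity hω hl hβ hN hT hγ γ₁ hw hw' hvc hLw hLw' hR (χ := χ R) (fun x => rfl)).symm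
  have hLHS : Tendsto (fun R => ∫ x, χ R x * w x * v' x * ρ x) atTop (𝓝 (∫ x, w x * v' x * ρ x)) := hL1
  have := tendsto_nhds_unique hLHS hRHS
  rw [this]
  ring

end Pinned

end Pencil

/-! ## Registered helper stub -/

open Pencil in
/-- **Registered sub-goal `stub_pencilOfGreenKubo_crossPairing`** of the crux (this file's ticket): the cross-friction
pairing identity (= `Pencil.cross_pairing`). [folklore] -/
theorem stub_pencilOfGreenKubo_crossPairing :
    ∀ (N : ℕ) (ω₂ lam β : ℝ), 0 < ω₂ → 0 ≤ lam → 0 ≤ β → ∀ (hN : 2 ≤ N) (T : ℝ), 0 < T → ∀ (γ : ℝ), 0 ≤ γ → ∀ (γ₁ : ℝ) (w v w' v' : Literature.MathematicalPhysics.KineticTheory.HeatConduction.PhaseSpace N → ℝ), ContDiff ℝ ((⊤ : ℕ∞) : WithTop ℕ∞) w → ContDiff ℝ ((⊤ : ℕ∞) : WithTop ℕ∞) w' → Continuous v → Continuous v' → (∀ x, (Literature.MathematicalPhysics.KineticTheory.HeatConduction.pinnedChain ω₂ lam β γ₁).generator N T T w x = -v x) → (∀ x : Literature.MathematicalPhysics.KineticTheory.HeatConduction.PhaseSpace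 N, (Literature.MathematicalPhysics.KineticTheory.HeatConduction.pinnedChain ω₂ lam β γ).generator N T T (fun y : Literature.MathematicalPhysics.KineticTheory.HeatConduction.PhaseSpace N => w' (y.1, -y.2)) (x.1, -x.2) = -v' x) → ∀ (Cw Cv Cw' Cv' : ℝ), (∀ z, |w z| ≤ Cw * Real.exp ((Literature.MathematicalPhysics.KineticTheory.HeatConduction.pinnedChain ω₂ lam β γ).hamiltonian N z / (8 * T))) → (∀ z, |v z| ≤ Cv * Real.exp ((Literature.MathematicalPhysics.KineticTheory.HeatConduction.pinnedChain ω₂ lam β γ).hamiltonian N z / (8 * T))) → (∀ z, |w' z| ≤ Cw' * Real.exp ((Literature.MathematicalPhysics.KineticTheory.HeatConduction.pinnedChain ω₂ lam β γ).hamiltonian N z / (8 * T))) → (∀ z, |v' z| ≤ Cv' * Real.exp ((Literature.MathematicalPhysics.KineticTheory.HeatConduction.pinnedChain ω₂ lam β γ).hamiltonian N z / (8 * T))) → MeasureTheory.Integrable (fun x => (Literature.MathematicalPhysics.KineticTheory.HeatConduction.partialP ⟨0, by omega⟩ w x) ^ 2 * (Literature.MathematicalPhysics.KineticTheory.HeatConduction.pinnedChain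 ω₂ lam β γ).gibbsDensity N T x) → MeasureTheory.Integrable (fun x => (Literature.MathematicalPhysics.KineticTheory.HeatConduction.partialP ⟨N - 1, by omega⟩ w x) ^ 2 * (Literature.MathematicalPhysics.KineticTheory.HeatConduction.pinnedChain ω₂ lam β γ).gibbsDensity N T x) → MeasureTheory.Integrable (fun x => (Literature.MathematicalPhysics.KineticTheory.HeatConduction.partialP ⟨0, by omega⟩ w' x) ^ 2 * (Literature.MathematicalPhysics.KineticTheory.HeatConduction.pinnedChain ω₂ lam β γ).gibbsDensity N T x) → MeasureTheory.Integrable (fun x => (Literature.MathematicalPhysics.KineticTheory.HeatConduction.partialP ⟨N - 1, by omega⟩ w' x) ^ 2 * (Literature.MathematicalPhysics.KineticTheory.HeatConduction.pinnedChain ω₂ lam β γ).gibbsDensity N T x) → ∫ x, w x * v' x * (Literature.MathematicalPhysics.KineticTheory.HeatConduction.pinnedChain ω₂ lam β γ).gibbsDensity N T x = (∫ x, v x * w' x * (Literature.MathematicalPhysics.KineticTheory.HeatConduction.pinnedChain ω₂ lam β γ).gibbsDensity N T x) + (γ - γ₁) * T * ((∫ x, Literature.MathematicalPhysics.KineticTheory.HeatConduction.partialP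 ⟨0, by omega⟩ w' x * Literature.MathematicalPhysics.KineticTheory.HeatConduction.partialP ⟨0, by omega⟩ w x * (Literature.MathematicalPhysics.KineticTheory.HeatConduction.pinnedChain ω₂ lam β γ).gibbsDensity N T x) + ∫ x, Literature.MathematicalPhysics.KineticTheory.HeatConduction.partialP ⟨N - 1, by omega⟩ w' x * Literature.MathematicalPhysics.KineticTheory.HeatConduction.partialP ⟨N - 1, by omega⟩ w x * (Literature.MathematicalPhysics.KineticTheory.HeatConduction.pinnedChain ω₂ lam β γ).gibbsDensity N T x) :=
  fun _ _ _ _ hω hl hβ hN _ hT _ hγ γ₁ _ _ _ _ hw hw' hvc hv'c hLw hLw' _ _ _ _ hwb hvb hw'b hv'b hD₀ hD₁ hD'₀ hD'₁ =>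
    cross_pairing hω hl hβ hN hT hγ γ₁ hw hw' hvc hv'c hLw hLw' hwb hvb hw'b hv'b hD₀ hD₁ hD'₀ hD'₁

end Summit.AtomisticToContinuum.FouriersLaw.Theorems.ContactStieltjesMeasure.CayleyPencil

end
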